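import Literature.Geometry.Symplectic.OrigamiCutFormProduct
import Mathlib.LinearAlgebra.Complex.FiniteDimensional

/-!
# Helper `helper_areaFormFamily` of stub `stub_croftonTaming` — line `crofton-pencil-laminar-charge`,
crux `SullivanDual.Target` (stmt-SmoothPoincare4-7823), skeleton v2
(`Cruxes/Target/Lines/crofton_pencil_laminar_charge.lean`)

The Crofton taming form of the line is a parametric integral of pull-backs of ONE smooth
`2`-form `β` on the vector space `ℂ × ℂ` (coordinates `(a, b)`: direction and intercept of a
complex line): `β = ρ(a, b) · pr₂^* dA`, where `dA(σ, τ) = σ.re τ.im - σ.im τ.re` is the area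
form of the intercept plane `ℂ_b` and `ρ` a smooth weight.  This file constructs `β` for an
arbitrary `C^∞` weight `ρ : ℂ × ℂ → ℝ` and proves

* `β` is a smooth form (on a vector space the chart representative of a form is the form itself,
  tree `inChart_eq_self_model`, and `q ↦ ρ q • pr₂^* dA` is `C^∞` as a plain map);
* the evaluation formula `β_q(V, W) = ρ(q) · dA(V₂, W₂)`;
* `dβ_q((0, u), (0, v), (0, w)) = 0` for all `u v w : ℂ`: on the vector space `ℂ × ℂ` the
  manifold exterior derivative is Mathlib's `extDeriv` (tree `mextDeriv_eq_extDeriv`), and the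
  restriction of the `3`-form `dβ_q` along the inclusion `ℂ → {0} × ℂ ⊆ ℂ × ℂ` is an alternating
  `3`-form on the real `2`-dimensional space `ℂ`, hence vanishes (three vectors of `ℂ` are
  `ℝ`-linearly dependent, `AlternatingMap.map_linearDependent`).

The pulled-back area form `pr₂^* dA` is the tree's `areaAltC` (the area form of `ℂ` as a
continuous alternating `2`-form, `OrigamiCutFormProduct.lean`) composed with the second
projection (used inline; no new definitions).

## References

* F. W. Warner, *Foundations of Differentiable Manifolds and Lie Groups*, GTM 94 (1983),
  2.15–2.20 (forms on a vector space, the exterior derivative). [WarnerGTM94]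
-/

noncomputable section

-- the prescribed namespace `Summit.<P>.<Sub>.…` duplicates `SmoothPoincare4` (P = Sub)
set_option linter.dupNamespace false

open scoped Manifold ContDiff Topology
open Set Filter Literature.Geometry.Kaehler Literature.Geometry.Symplectic

namespace Summit.SmoothPoincare4.SmoothPoincare4.Theorems.Target.CroftonPencil

/-- The pulled-back area form `pr₂^* dA` on `ℂ × ℂ` (the area form `areaAltC` of the second
factor composed with the second projection) evaluates as
`pr₂^* dA (V, W) = dA(V₂, W₂) = V₂.re W₂.im - V₂.im W₂.re`. [folklore] -/
theorem sndAreaAlt_apply (V W : ℂ × ℂ) :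
    (areaAltC.compContinuousLinearMap (ContinuousLinearMap.snd ℝ ℂ ℂ)) ![V, W] =
      V.2.re * W.2.im - V.2.im * W.2.re := by
  have h : ((ContinuousLinearMap.snd ℝ ℂ ℂ : ℂ × ℂ → ℂ) ∘ ![V, W]) = ![V.2, W.2] := by
    funext i
    fin_cases i <;> rfl
  rw [ContinuousAlternatingMap.compContinuousLinearMap_apply, h, areaAltC_apply]

/-- An alternating `3`-form on the real plane `ℂ` vanishes: three vectors of a real
`2`-dimensional space are linearly dependent. [folklore] -/
theorem threeForm_complex_eq_zero (γ : ℂ [⋀^Fin 3]→L[ℝ] ℝ) (v : Fin 3 → ℂ) : γ v = 0 := by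
  have h : ¬ LinearIndependent ℝ v := by
    intro hli
    have hc := hli.fintype_card_le_finrank
    rw [Complex.finrank_real_complex, Fintype.card_fin] at hc
    omega
  have h' := γ.toAlternatingMap.map_linearDependent v h
  rwa [ContinuousAlternatingMap.coe_toAlternatingMap] at h'

/-- **Registered helper `helper_areaFormFamily`** (signature registered verbatim on
stmt-SmoothPoincare4-7823).  For every `C^∞` weight `ρ : ℂ × ℂ → ℝ` the form
`β = ρ · pr₂^* dA` on the vector space `ℂ × ℂ` is a smooth `2`-form with
`β_q(V, W) = ρ(q) (V₂.re W₂.im - V₂.im W₂.re)` whose exterior derivative kills every triple of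
vectors tangent to the intercept plane `{0} × ℂ` (a `3`-form on a real plane is zero).
[cite: WarnerGTM94, 2.15–2.20] -/
theorem helper_areaFormFamily :
    ∀ (ρ : ℂ × ℂ → ℝ), ContDiff ℝ ∞ ρ →
      ∃ β : MForm 𝓘(ℝ, ℂ × ℂ) (ℂ × ℂ) ℝ 2, IsSmoothForm β ∧
        (∀ (q : ℂ × ℂ) (V W : ℂ × ℂ),
          β q ![V, W] = ρ q * (V.2.re * W.2.im - V.2.im * W.2.re)) ∧
        (∀ (q : ℂ × ℂ) (u v w : ℂ), mextDeriv β q ![((0 : ℂ), u), ((0 : ℂ), v), ((0 : ℂ), w)] = 0) := by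
  intro ρ hρ
  -- `β = ρ • pr₂^* dA`, a plain map `ℂ × ℂ → (ℂ × ℂ) [⋀^Fin 2]→L[ℝ] ℝ`
  refine ⟨fun q => ρ q • areaAltC.compContinuousLinearMap (ContinuousLinearMap.snd ℝ ℂ ℂ),
    ?_, ?_, ?_⟩
  · -- smoothness: the chart representative on the model vector space is the form itself
    intro x
    rw [inChart_eq_self_model]
    exact (hρ.smul contDiff_const).contDiffAt.contDiffWithinAt
  · -- evaluation formula
    intro q V W
    change (ρ q • areaAltC.compContinuousLinearMap (ContinuousLinearMap.snd ℝ ℂ ℂ)) ![V, W] = _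
    rw [ContinuousAlternatingMap.smul_apply, sndAreaAlt_apply, smul_eq_mul]
  · -- `dβ` vanishes on triples of vectors of the intercept plane
    intro q u v w
    rw [mextDeriv_eq_extDeriv]
    have hvec : ((ContinuousLinearMap.inr ℝ ℂ ℂ : ℂ → ℂ × ℂ) ∘ ![u, v, w]) =
        ![((0 : ℂ), u), ((0 : ℂ), v), ((0 : ℂ), w)] := by
      funext i
      fin_cases i <;> rfl
    have h0 := threeForm_complex_eq_zero
      ((extDeriv
          (fun q : ℂ × ℂ => ρ q • areaAltC.compContinuousLinearMap (ContinuousLinearMap.snd ℝ ℂ ℂ))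
          q).compContinuousLinearMap (ContinuousLinearMap.inr ℝ ℂ ℂ)) ![u, v, w]
    rwa [ContinuousAlternatingMap.compContinuousLinearMap_apply, hvec] at h0

end Summit.SmoothPoincare4.SmoothPoincare4.Theorems.Target.CroftonPencil

end
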